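import Literature.NumberTheory.EllipticCurves.HeegnerTraceRelationOrdersProofs
import Literature.NumberTheory.QuadraticFields.FundamentalDiscriminant
import HarnessLib

/-!
# The trace relation `Tr_{K[ℓm]/K[m]} y(ℓm) = a_ℓ · y(m)` for Gross's points `x(n)` under BIRCH's
# Heegner condition `4N ∣ β² − d_K` only (primes dividing both `N` and `d_K` allowed) — PROVED

Topic `NumberTheory/EllipticCurves` (complex multiplication / Heegner points; sequel of
`HeegnerTraceRelationOrdersProofs`), namespace `Literature.NumberTheory.EllipticCurves.HeegnerTraceBirch`.
THEOREMS ONLY: no definition, no named fact (D-0026); unconditional.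

`HeegnerTraceRelationProofs` proves Gross 1991, Prop. 3.7 (1) for the points
`x(n) = heegnerPointOfConductor d_K β n` under `gcd(N, d_K) = 1` (split Heegner hypothesis);
`HeegnerTraceRelationOrdersProofs` proves it for a CM point given by a level-`N` Heegner form `Q` of
discriminant `f² d_K` WITH BEZOUT DATA `uN + vB + wC' = 1` (`sum_pointGalHom_eq_lFunction_smul_bezout`),
with no hypothesis on `gcd(N, d_K)`. This file supplies the Bezout data for Gross's forms
`heegnerFormOfConductor d_K β m = (m²(β² − d_K)/4, mβ, 1)` from BIRCH's condition alone:

* §1 `isUnit_gcd_of_birch` / `exists_bezout_of_birch` — for a FUNDAMENTAL discriminant `d_K` with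
  `β² − d_K = 4Nk` and `gcd(m, N) = 1` there are `u, v, w` with `uN + v(mβ) + w(m²k) = 1`: a prime `r`
  dividing `N`, `β` and `k` divides `d_K = β² − 4Nk` to the second power (`r` odd), resp. forces
  `d_K/4 ≡ (β/2)² ≡ 0, 1 (mod 4)` (`r = 2`) — against `not_sq_dvd_discr_of_prime_ne_two`,
  `discr_div_four_emod_four` (`QuadraticFields/FundamentalDiscriminant`). This is the observation that
  Birch's `4N ∣ β² − D` already makes the ideal `𝒩 = (N, (−β + √D)/2)` proper at the primes of
  `gcd(N, D)` (they divide `N` exactly once).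
* §2 `heegnerFormOfConductor_mul` — `x(ℓm)` is the form `(ℓ²A, ℓB, C)` over `x(m) = τ_{(A,B,C)}`
  (Gross: `x_{ℓm} = x_m/ℓ`).
* §3 **`sum_pointGalHom_eq_lFunction_smul_of_birch`** — for `K` imaginary quadratic, `ι : K → ℂ`, ANY
  `Dt : ModularParametrizationData W N`, `4N ∣ β² − d_K`, `ℓ` prime inert in `K` with `ℓ ∤ N`, `ℓ ∤ m`,
  `gcd(m, N) = 1`, `m ≥ 2 ∨ d_K < −4`, and `y, y₀ ∈ E(K[ℓm])` over `φ(x(ℓm))`, `φ(x(m))`: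
  `Σ_{g ∈ Gal(K[ℓm]/K[m])} g·y = a_ℓ · y₀` with `a_ℓ = W.LFunction ℓ`; and the `E(ℂ)`-valued form
  `map_sum_pointGalHom_eq_lFunction_smul_of_birch`.

In print: Gross 1984 (*Heegner points on `X₀(N)`*, §§4–6) works throughout with `D ≡ β² (mod 4N)`;
Gross 1991 Prop. 3.7 (1) and Darmon 2004 Prop. 3.10 print the relation under the split hypothesis, with
proofs (Hecke correspondence `T_ℓ` for `ℓ ∤ N` + Eichler–Shimura) that do not involve the primes of
`gcd(N, D)`. Consumer: the genus-transport line `three_field_road` of crux `GordTwoRankZeroOffCaseOne`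
(its fourth curve `E′` has a Steinberg prime ramified in the Kolyvagin field `K″`).

## References
* B. H. Gross, *Kolyvagin's work on modular elliptic curves*, LMS LNS 153 (1991), Prop. 3.7 (1)
  (PDF p. 217 l. 19 – p. 218 l. 8 of `book:editornd-l-functions-arithmetic`). [GrossLMS1991]
* B. H. Gross, *Heegner points on `X₀(N)`*, in *Modular Forms* (Durham 1983), §I.3, §§4–6. [Gross1984]
* J. Nekovář, *The Euler system method for CM points on Shimura curves*, LMS LNS 320 (2007),
  Prop. (4.13) (i). [Nekovar2007]

presearch: Gross 1991 Prop. 3.7 (1) [corpus: book:editornd-l-functions-arithmetic p. 217–218] (split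
hypothesis); Nekovář 2007 (4.13) (i) [corpus: book:burns2007-l-functions-galois-representations p. 0573]
(general orders); `lean search 'smul_bezout|of_birch'` → the Orders theorem and the Birch-keyed CM
rationality fact only; no Birch-keyed trace relation in the tree.
-/

noncomputable section

open scoped Classical MatrixGroups
open Complex UpperHalfPlane CongruenceSubgroup NumberField Module
open Literature.NumberTheory.EllipticCurves.RingClassField
open Literature.NumberTheory.EllipticCurves.ModularForms

namespace Literature.NumberTheory.EllipticCurves

open Literature.NumberTheory.QuadraticFields.BinaryQuadraticForm
  Literature.NumberTheory.QuadraticFields.Quadratic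

namespace HeegnerTraceBirch

open HeegnerTraceOrders

variable {K : Type} [Field K] [NumberField K]

/-! ## §1 Bezout data from Birch's condition -/

/-- **No prime divides `N`, `β` and `k` when `β² − d_K = 4Nk` with `d_K` fundamental.** An odd such
prime `r` would give `r² ∣ β² − 4Nk = d_K`; `r = 2` would give `d_K/4 = (β/2)² − Nk ≡ 0, 1 (mod 4)`.
[cite: Gross1984, §I.3] -/
theorem not_dvd_of_birch (hK : IsImaginaryQuadratic K) {N : ℕ} {β k : ℤ}
    (hk : β ^ 2 - NumberField.discr K = 4 * N * k) {r : ℕ} (hr : r.Prime)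
    (hrN : (r : ℤ) ∣ N) (hrβ : (r : ℤ) ∣ β) (hrk : (r : ℤ) ∣ k) : False := by
  obtain ⟨N', hN'⟩ := hrN
  obtain ⟨b, hb⟩ := hrβ
  obtain ⟨k', hk'⟩ := hrk
  subst hb hk'
  by_cases hr2 : r = 2
  · subst hr2
    push_cast at hN' hk
    have hD : NumberField.discr K = 4 * (b ^ 2 - 4 * (N' * k')) := by
      linear_combination -hk - 8 * k' * hN'
    have h4 : (4 : ℤ) ∣ NumberField.discr K := ⟨_, hD⟩
    have hq : NumberField.discr K / 4 = b ^ 2 - 4 * (N' * k') := by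
      rw [hD, Int.mul_ediv_cancel_left _ (by norm_num)]
    have hmod := discr_div_four_emod_four (K := K) hK.1 h4
    rw [hq] at hmod
    have hb2 : b ^ 2 % 4 = 0 ∨ b ^ 2 % 4 = 1 := by
      rcases Int.even_or_odd b with ⟨c, rfl⟩ | hodd
      · left
        rw [show (c + c) ^ 2 = 4 * (c * c) by ring]
        exact Int.mul_emod_right _ _
      · right
        exact Int.sq_mod_four_eq_one_of_odd hodd
    omega
  · have hsq : ((r : ℤ) ^ 2 ∣ NumberField.discr K) :=
      ⟨b ^ 2 - 4 * N' * k', by linear_combination -hk - 4 * (r : ℤ) * k' * hN'⟩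
    exact not_sq_dvd_discr_of_prime_ne_two (K := K) hK.1 hr hr2 hsq

/-- **Bezout data for Gross's form of conductor `m` under Birch's condition**: with `β² − d_K = 4Nk`
(`d_K` fundamental) and `gcd(m, N) = 1` there are `u, v, w ∈ ℤ` with `uN + v(mβ) + w(m²k) = 1` — the
hypothesis `huvw` of `HeegnerTraceOrders.sum_pointGalHom_eq_lFunction_smul_bezout` for the form
`(m²k·N, mβ, 1)`… read with `C' = m²k`. [cite: Gross1984, §I.3] -/
theorem exists_bezout_of_birch (hK : IsImaginaryQuadratic K) {N : ℕ} {β k : ℤ}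
    (hk : β ^ 2 - NumberField.discr K = 4 * N * k) {m : ℕ} (hmN : Nat.Coprime m N) :
    ∃ u v w : ℤ, u * N + v * (m * β) + w * ((m : ℤ) ^ 2 * k) = 1 := by
  -- the gcd of the three numbers is `1`: no prime divides all of them
  set g₁ : ℕ := Int.gcd (N : ℤ) (m * β) with hg₁
  set g : ℕ := Int.gcd (g₁ : ℤ) ((m : ℤ) ^ 2 * k) with hg
  have hg1 : g = 1 := by
    refine Nat.eq_one_iff_not_exists_prime_dvd.mpr fun r hr hrg => ?_
    have hrI : Prime (r : ℤ) := Nat.prime_iff_prime_int.mp hr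
    have hrg₁ : (r : ℤ) ∣ (g₁ : ℤ) :=
      (Int.natCast_dvd_natCast.mpr hrg).trans (Int.gcd_dvd_left _ _)
    have hrN : (r : ℤ) ∣ (N : ℤ) := hrg₁.trans (Int.gcd_dvd_left _ _)
    have hrmβ : (r : ℤ) ∣ m * β := hrg₁.trans (Int.gcd_dvd_right _ _)
    have hrm2k : (r : ℤ) ∣ (m : ℤ) ^ 2 * k :=
      (Int.natCast_dvd_natCast.mpr hrg).trans (Int.gcd_dvd_right _ _)
    -- `r ∤ m` as `gcd(m, N) = 1`
    have hrm : ¬ (r : ℤ) ∣ (m : ℤ) := by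
      intro h
      have h1 : r ∣ Nat.gcd m N :=
        Nat.dvd_gcd (Int.natCast_dvd_natCast.mp h) (Int.natCast_dvd_natCast.mp hrN)
      rw [hmN] at h1
      exact hr.one_lt.ne' (Nat.dvd_one.mp h1)
    have hrβ : (r : ℤ) ∣ β := (hrI.dvd_or_dvd hrmβ).resolve_left hrm
    have hrk : (r : ℤ) ∣ k := by
      rcases hrI.dvd_or_dvd hrm2k with h | h
      · exact absurd (hrI.dvd_of_dvd_pow h) hrm
      · exact h
    exact not_dvd_of_birch hK hk hr hrN hrβ hrk
  -- Bezout, twice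
  refine ⟨Int.gcdA (N : ℤ) (m * β) * Int.gcdA (g₁ : ℤ) ((m : ℤ) ^ 2 * k),
    Int.gcdB (N : ℤ) (m * β) * Int.gcdA (g₁ : ℤ) ((m : ℤ) ^ 2 * k),
    Int.gcdB (g₁ : ℤ) ((m : ℤ) ^ 2 * k), ?_⟩
  have h1 : ((g₁ : ℕ) : ℤ) = (N : ℤ) * Int.gcdA (N : ℤ) (m * β) + m * β * Int.gcdB (N : ℤ) (m * β) :=
    Int.gcd_eq_gcd_ab _ _
  have h2 : ((g : ℕ) : ℤ) = (g₁ : ℤ) * Int.gcdA (g₁ : ℤ) ((m : ℤ) ^ 2 * k) +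
      (m : ℤ) ^ 2 * k * Int.gcdB (g₁ : ℤ) ((m : ℤ) ^ 2 * k) := Int.gcd_eq_gcd_ab _ _
  rw [hg1, Nat.cast_one] at h2
  linear_combination (-Int.gcdA (g₁ : ℤ) ((m : ℤ) ^ 2 * k)) * h1 - h2

/-! ## §2 `x(ℓm) = x(m)/ℓ` on the forms -/

/-- Gross's form of conductor `ℓm` is `(ℓ²A, ℓB, C)` for `(A, B, C)` the form of conductor `m`
(`x_{ℓm} = x_m/ℓ`). [cite: GrossLMS1991, §3 (x_n)] -/
theorem heegnerFormOfConductor_mul (D β : ℤ) (ℓ m : ℕ) :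
    heegnerFormOfConductor D β (ℓ * m) =
      ((ℓ : ℤ) ^ 2 * (heegnerFormOfConductor D β m).1, (ℓ : ℤ) * (heegnerFormOfConductor D β m).2.1,
        (heegnerFormOfConductor D β m).2.2) := by
  simp only [heegnerFormOfConductor, Nat.cast_mul]
  refine Prod.ext ?_ (Prod.ext ?_ rfl)
  · ring
  · ring

/-! ## §3 The trace relation under Birch's condition -/

/-- **Gross 1991, Prop. 3.7 (1), for `x(n)` under Birch's condition, in `E(ℂ)`**: for `K` imaginary
quadratic, `ι : K → ℂ`, any parametrisation datum `Dt` of level `N`, `4N ∣ β² − d_K`, a prime `ℓ ∤ N`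
inert in `K` with `ℓ ∤ m`, `m ≥ 1` prime to `N`, `m ≥ 2 ∨ d_K < −4`, `n = ℓm`, and `y ∈ E(K[n])` over
`φ(x(n))`: `(Σ_{g ∈ Gal(K[n]/K[m])} g·y)_ℂ = a_ℓ · φ(x(m))`, `a_ℓ = W.LFunction ℓ`. The split Heegner
hypothesis of `HeegnerTraceRelationProofs` is replaced by §1's Bezout data.
[cite: GrossLMS1991, §3 Prop. 3.7 (1)] [cite: Gross1984, §6] [cite: Nekovar2007, Prop. (4.13) (i)] -/
theorem map_sum_pointGalHom_eq_lFunction_smul_of_birch (hK : IsImaginaryQuadratic K) (ι : K →+* ℂ)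
    {N : ℕ} [NeZero N] {W : WeierstrassCurve ℚ} (Dt : ModularParametrizationData W N) {β : ℤ}
    (hβ : (4 * N : ℤ) ∣ β ^ 2 - NumberField.discr K) {ℓ m n : ℕ} (hℓ : ℓ.Prime)
    (hinert : (Ideal.span {(ℓ : 𝓞 K)}).IsPrime) (hℓN : ¬ ℓ ∣ N) (hℓm : ¬ ℓ ∣ m) (hm : m ≠ 0)
    (hmN : Nat.Coprime m N) (hunits : 2 ≤ m ∨ NumberField.discr K < -4) (hn : ℓ * m = n)
    {G : Finset (ringClassField K ι n ≃ₐ[ℚ] ringClassField K ι n)}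
    (hG : ∀ g, g ∈ G ↔ g ∈ ringClassGalOver ι n m)
    {y : (W.baseChange (ringClassField K ι n)).toAffine.Point}
    (hy : WeierstrassCurve.Affine.Point.map (W' := W) (ringClassField K ι n).subtype.toRatAlgHom y =
      heegnerPointComplexOfConductor Dt (NumberField.discr K) β n) :
    WeierstrassCurve.Affine.Point.map (W' := W) (ringClassField K ι n).subtype.toRatAlgHom
        (∑ g ∈ G, pointGalHom W (ringClassField K ι n) g y) =
      W.LFunction ℓ • heegnerPointComplexOfConductor Dt (NumberField.discr K) β m := by
  obtain ⟨k, hk⟩ := hβ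
  have hQ := heegnerFormOfConductor_mem_heegnerForms (N := N) hK.discr_neg ⟨k, hk⟩ hm
  obtain ⟨u, v, w, huvw⟩ := exists_bezout_of_birch hK hk hmN
  have hc : 4 * (N : ℤ) * ((m : ℤ) ^ 2 * k) =
      (heegnerFormOfConductor (NumberField.discr K) β m).2.1 ^ 2 - (m : ℤ) ^ 2 * NumberField.discr K := by
    simp only [heegnerFormOfConductor]
    linear_combination (-((m : ℤ) ^ 2)) * hk
  have hβ' : (heegnerFormOfConductor (NumberField.discr K) β m).2.1 ≡
      (heegnerFormOfConductor (NumberField.discr K) β m).2.1 [ZMOD 2 * N] := Int.ModEq.refl _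
  have huvw' : u * N + v * (heegnerFormOfConductor (NumberField.discr K) β m).2.1 +
      w * ((m : ℤ) ^ 2 * k) = 1 := by
    simpa only [heegnerFormOfConductor] using huvw
  have hℓC : ¬ (ℓ : ℤ) ∣ (heegnerFormOfConductor (NumberField.discr K) β m).2.2 := by
    change ¬ (ℓ : ℤ) ∣ 1
    intro h
    have h1 : (ℓ : ℤ) = 1 := Int.eq_one_of_dvd_one (Int.natCast_nonneg ℓ) h
    exact hℓ.ne_one (by exact_mod_cast h1)
  have hform : heegnerFormOfConductor (NumberField.discr K) β n =
      ((ℓ : ℤ) ^ 2 * (heegnerFormOfConductor (NumberField.discr K) β m).1,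
        (ℓ : ℤ) * (heegnerFormOfConductor (NumberField.discr K) β m).2.1,
        (heegnerFormOfConductor (NumberField.discr K) β m).2.2) := by
    rw [← hn]
    exact heegnerFormOfConductor_mul _ _ _ _
  have hy' : WeierstrassCurve.Affine.Point.map (W' := W) (ringClassField K ι n).subtype.toRatAlgHom y =
      Dt.φ (heegnerTau ((ℓ : ℤ) ^ 2 * (heegnerFormOfConductor (NumberField.discr K) β m).1,
        (ℓ : ℤ) * (heegnerFormOfConductor (NumberField.discr K) β m).2.1,
        (heegnerFormOfConductor (NumberField.discr K) β m).2.2)) := by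
    rw [hy, heegnerPointComplexOfConductor, heegnerPointOfConductor, hform]
  -- a point over `φ(x(m))` inside `E(K[n])`, to read the relation through `E(K[n]) → E(ℂ)`
  rw [map_sum]
  have key := map_sum_pointGalHom_eq_lFunction_smul_of_fix_of_eq hK ι Dt hℓ hinert hℓN hℓm hm hunits hn
    (fun σ hσ => levelTransport_self_of_fix_ringClassField_bezout hK ι hm hQ.1 hβ' hc huvw' hσ)
    (conductorMul_mem_heegnerForms hQ.1 hℓ hℓC).2.1
    ((isPrimitive_iff_binQF _).mpr
      ((BinQF.isPrimitive_iff _).mpr (conductorMul_mem_heegnerForms hQ.1 hℓ hℓC).2.2.2))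
    ?_ (isHeckeNeighbour_heegnerTau_conductorMul hQ.1.2.1
      (hQ.1.1.trans_lt (mul_neg_of_pos_of_neg (by positivity) hK.discr_neg)) hℓ) hG hy'
  · rw [map_sum] at key
    rw [key, heegnerPointComplexOfConductor, heegnerPointOfConductor]
  · have h0 := hQ.1.1
    rw [← hn, QuadraticFields.BinaryQuadraticForm.discr_apply]
    push_cast
    linear_combination (ℓ : ℤ) ^ 2 * h0

/-- **The identity read inside `E(K[n])`**: with moreover `y₀ ∈ E(K[n])` over `φ(x(m))`,
`Σ_{g ∈ Gal(K[n]/K[m])} g·y = a_ℓ · y₀` (injectivity of `E(K[n]) → E(ℂ)`).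
[cite: GrossLMS1991, §3 Prop. 3.7 (1) ("in `E(K_m)`")] -/
theorem sum_pointGalHom_eq_lFunction_smul_of_birch (hK : IsImaginaryQuadratic K) (ι : K →+* ℂ)
    {N : ℕ} [NeZero N] {W : WeierstrassCurve ℚ} (Dt : ModularParametrizationData W N) {β : ℤ}
    (hβ : (4 * N : ℤ) ∣ β ^ 2 - NumberField.discr K) {ℓ m n : ℕ} (hℓ : ℓ.Prime)
    (hinert : (Ideal.span {(ℓ : 𝓞 K)}).IsPrime) (hℓN : ¬ ℓ ∣ N) (hℓm : ¬ ℓ ∣ m) (hm : m ≠ 0)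
    (hmN : Nat.Coprime m N) (hunits : 2 ≤ m ∨ NumberField.discr K < -4) (hn : ℓ * m = n)
    {G : Finset (ringClassField K ι n ≃ₐ[ℚ] ringClassField K ι n)}
    (hG : ∀ g, g ∈ G ↔ g ∈ ringClassGalOver ι n m)
    {y y₀ : (W.baseChange (ringClassField K ι n)).toAffine.Point}
    (hy : WeierstrassCurve.Affine.Point.map (W' := W) (ringClassField K ι n).subtype.toRatAlgHom y =
      heegnerPointComplexOfConductor Dt (NumberField.discr K) β n)
    (hy₀ : WeierstrassCurve.Affine.Point.map (W' := W) (ringClassField K ι n).subtype.toRatAlgHom y₀ =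
      heegnerPointComplexOfConductor Dt (NumberField.discr K) β m) :
    ∑ g ∈ G, pointGalHom W (ringClassField K ι n) g y = W.LFunction ℓ • y₀ := by
  apply WeierstrassCurve.Affine.Point.map_injective (f := (ringClassField K ι n).subtype.toRatAlgHom)
  rw [map_zsmul, hy₀]
  exact map_sum_pointGalHom_eq_lFunction_smul_of_birch hK ι Dt hβ hℓ hinert hℓN hℓm hm hmN hunits hn hG hy

end HeegnerTraceBirch

end Literature.NumberTheory.EllipticCurves
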